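import Summits.ResolutionOfSingularities.ResolutionOfSingularities.Theorems.PurelyInseparableDim4ResConeLevelTwoTransport
import HarnessLib
import HarnessLib.Audit.Tags

/-!
# Purely inseparable four-folds — LEVEL-2 TRANSPORT of a double ledger through the SELF-CHART step
# (chart letter = one ledger letter; cell `res-dim4-pi`, K2(p) lane, slice B brick K19)

[OURS · counted 0 · cell `res-dim4-pi` · K2(p) lane holder res-dim4-p-12 g3's brick by signature (bus
2026-08-29 00:12Z, SLICE-B-ARCH v1.4 §9 K7-prep), seat res-dim4-p-3 g3.]  Nothing here proves K2(p),
`NoIsolatedTrap p p` or resolution of singularities in dimension ≥ 4 / characteristic `p`; K16–K19 are bookkeeping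
for the light regime (I-4-7 class C∞) only.

res-dim4-p-9 g3's K17 (`ResCone.levelTwo_transport`) transports a double ledger `u·G = S·(x_a x_{b′}) + T·h^d`
through a point step that KEEPS both letters (`j ∉ {a, b′}`).  Here the chart letter IS the ledger letter `a`
(`j = a`): the divisor `E_a` is replaced by the new exceptional divisor `E_j = E_a` of weight `o − q`, `E_{b′}`
is kept (`b_{b′} = 0`, `1 ≤ r_{b′} ≤ q − 2`), and in the band `o + 2 ≤ 2q`:
* `deleted_mem_span_sq_self` — the deleted `q`-th powers lie in `(x_a² x_{b′}²)`: `q ∣ E_a ≥ r′_a = o − q ≥ 1`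
  forces `E_a − r′_a ≥ 2q − o ≥ 2`, and `E_{b′} − r_{b′} ≥ q − r_{b′} ≥ 2` as in K17;
* **`levelTwo_transport_self`** — `T₀u · G′ = S′·(x_a x_{b′}) + (U·T₀T)·(T₁h)^d` with
  `S′ ≡ U · T_{d−1}S (mod x_a x_{b′})` (`T_m := chartTransform m univ j ∘ shear j b`, `U` the lost units):
  since `σ_j(x_j) = x_j` the transform of the identity is `T_d(uG) = x_a x_{b′}·T_{d−1}S + T₀T·(T₁h)^d` — «when a
  ledger letter is re-created the merged level-2 cofactor transforms with exponent `d − 1`» (I-4-7: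
  `Ã₀′ = Ã₀∘σ / x_j^{d−1}`).
bears_on: LADDER-RESOLUTION:D157-DOOR2 (res-dim4-pi · K2(p) · slice B · K19).  Supports
stmt-ResolutionOfSingularities-16155 (helper).
-/

set_option linter.dupNamespace false -- mandated namespace of this single-conjunct summit

noncomputable section

namespace Summit.ResolutionOfSingularities.ResolutionOfSingularities.Theorems.PIDim4

namespace ResCone

open MvPolynomial Finset
open Literature.AlgebraicGeometry.Resolution
open Literature.AlgebraicGeometry.Resolution.CentreBlowup
open Literature.AlgebraicGeometry.Resolution.Hauser2010
open Literature.AlgebraicGeometry.Resolution.HauserPerlega2019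

variable {K : Type} [Field K]

section Step

variable [DecidableEq K]

/-- **The deleted `q`-th powers of the self-chart step lie in `(x_j² x_{b′}²)`** when `E_{b′}` is kept with
`1 ≤ r_{b′} ≤ q − 2` and the band satisfies `q < o`, `o + 2 ≤ 2q` (`q ∣ E_j ≥ r′_j = o − q ≥ 1` forces
`E_j − r′_j ≥ 2q − o ≥ 2`). [folklore] -/
theorem deleted_mem_span_sq_self {q : ℕ} (j : Fin 4) {b : Fin 4 → K} (hbj : b j = 0) {s : State K} {o : ℕ}
    (ho : ordZero s.F = o) (hr : ∀ d ∈ s.F.support, s.r ≤ d) (hqo : q < o) (ho2 : o + 2 ≤ 2 * q) {b' : Fin 4}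
    (hjb : j ≠ b') (hbb : b b' = 0) (hrb : 1 ≤ s.r b') (hrbq : s.r b' + 2 ≤ q) :
    ∑ E ∈ (chartTransform q Finset.univ j (shear j b s.F)).support with IsPthPowerExponent q E,
        monomial (E - (CentreBlowup.step q Finset.univ j b s).r)
          (coeff E (chartTransform q Finset.univ j (shear j b s.F))) ∈
      Ideal.span {((X j * X b') ^ 2 : MvPolynomial (Fin 4) K)} := by
  set r' := (CentreBlowup.step q Finset.univ j b s).r with hr'
  have hr'j : r' j = o - q := by
    rw [hr', step_r_univ q j hbj s ho hr, Finsupp.update_apply, if_pos rfl]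
  have hr'b : r' b' = s.r b' := by
    rw [hr', step_r_univ q j hbj s ho hr, Finsupp.update_apply, if_neg hjb.symm, Finsupp.filter_apply, if_pos hbb]
  refine Ideal.sum_mem _ fun E hE => ?_
  obtain ⟨hEs, hP⟩ := Finset.mem_filter.mp hE
  have hle : r' ≤ E := step_r_le_of_mem_support_chartTransform_shear j hbj ho hr hqo.le hEs
  have hEj : q ≤ E j := Nat.le_of_dvd (by have := hle j; omega) ((isPthPowerExponent_iff q E).mp hP j)
  have hEb : q ≤ E b' := Nat.le_of_dvd (by have := hle b'; omega) ((isPthPowerExponent_iff q E).mp hP b')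
  have h2j : 2 ≤ (E - r') j := by rw [Finsupp.tsub_apply, hr'j]; omega
  have h2b : 2 ≤ (E - r') b' := by rw [Finsupp.tsub_apply, hr'b]; omega
  have hle2 : Finsupp.single j 2 + Finsupp.single b' 2 ≤ E - r' := by
    intro i
    rw [Finsupp.add_apply]
    by_cases hij : i = j
    · rw [hij, Finsupp.single_eq_same, Finsupp.single_eq_of_ne hjb]; exact h2j
    · by_cases hib : i = b'
      · rw [hib, Finsupp.single_eq_of_ne (Ne.symm hjb), Finsupp.single_eq_same]; exact h2b
      · rw [Finsupp.single_eq_of_ne hij, Finsupp.single_eq_of_ne hib]; exact Nat.zero_le _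
  refine Ideal.mem_span_singleton.mpr ⟨monomial (E - r' - (Finsupp.single j 2 + Finsupp.single b' 2))
    (coeff E (chartTransform q Finset.univ j (shear j b s.F))), ?_⟩
  rw [show ((X j * X b') ^ 2 : MvPolynomial (Fin 4) K) = monomial (Finsupp.single j 2 + Finsupp.single b' 2) 1 by
      rw [mul_pow, X_pow_eq_monomial, X_pow_eq_monomial, monomial_mul, one_mul],
    monomial_mul, one_mul, add_tsub_cancel_of_le hle2]

/-- **LEVEL-2 SELF-CHART TRANSPORT** (memo v1.4 §9, brick K19): at the point step with chart letter `j = a`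
EQUAL to one ledger letter and the other `b′ ≠ j` kept (`b_{b′} = 0`, `1 ≤ r_{b′} ≤ q − 2`), in the band
`q < ord₀ F = o`, `o + 2 ≤ 2q`, a double ledger `u·G = S·(x_a x_{b′}) + T·h^d` of the residual (`x^r ∣ F`,
`d = o − |r| ≥ 1`, `h ∈ 𝔪₀`, `ord S ≥ d − 1`) transports as
`T₀u · G′ = S′·(x_a x_{b′}) + (U·T₀T)·(T₁h)^d` with `S′ ≡ U · T_{d−1}S (mod x_a x_{b′})` — the new
`E_j = E_a` carries the cofactor with exponent `d − 1` and no extra `x_j` (I-4-7 C∞: `Ã₀′ = Ã₀∘σ / x_j^{d−1}`).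
[OURS] [cite: CossartJannsenSaito2020, Thm. 3.10(4), Thm. 9.3] -/
theorem levelTwo_transport_self {q : ℕ} (j : Fin 4) {b : Fin 4 → K} (hbj : b j = 0) {s : State K} {o : ℕ}
    (ho : ordZero s.F = o) (hr : ∀ d ∈ s.F.support, s.r ≤ d) (hqo : q < o) (ho2 : o + 2 ≤ 2 * q)
    {a b' : Fin 4} (hja : j = a) (hjb : j ≠ b') (hbb : b b' = 0) (hrb : 1 ≤ s.r b') (hrbq : s.r b' + 2 ≤ q)
    (hd1 : 1 ≤ o - s.r.degree) {h u S T : MvPolynomial (Fin 4) K} (hh : h ∈ originIdeal K)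
    (hG : u * s.F.divMonomial s.r = S * (X a * X b') + T * h ^ (o - s.r.degree))
    (hS : ∀ m ∈ S.support, o - s.r.degree - 1 ≤ m.degree) :
    ∃ S' : MvPolynomial (Fin 4) K,
      chartTransform 0 Finset.univ j (shear j b u) *
          ((CentreBlowup.step q Finset.univ j b s).F.divMonomial (CentreBlowup.step q Finset.univ j b s).r) =
        S' * (X a * X b') +
          ((∏ i ∈ Finset.univ.filter (fun i => b i ≠ 0), (X i + C (b i)) ^ (s.r i)) *
            chartTransform 0 Finset.univ j (shear j b T)) *
            chartTransform 1 Finset.univ j (shear j b h) ^ (o - s.r.degree) ∧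
      S' - (∏ i ∈ Finset.univ.filter (fun i => b i ≠ 0), (X i + C (b i)) ^ (s.r i)) *
          chartTransform (o - s.r.degree - 1) Finset.univ j (shear j b S) ∈
        Ideal.span {(X a * X b' : MvPolynomial (Fin 4) K)} := by
  subst hja
  set d := o - s.r.degree with hd
  set G := s.F.divMonomial s.r with hGdef
  set r' := (CentreBlowup.step q Finset.univ j b s).r with hr'
  set G' := (CentreBlowup.step q Finset.univ j b s).F.divMonomial r' with hG'def
  set U0 : MvPolynomial (Fin 4) K :=
    ∏ i ∈ Finset.univ.filter (fun i => b i ≠ 0), (X i + C (b i)) ^ (s.r i) with hU0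
  -- (i) the deleted part is `(x_j x_{b′})² · c`
  obtain ⟨c, hc⟩ := Ideal.mem_span_singleton.mp
    (deleted_mem_span_sq_self j hbj ho hr hqo ho2 hjb hbb hrb hrbq)
  -- degrees
  have hGdeg : ∀ e ∈ G.support, d ≤ e.degree := forall_le_degree_divMonomial ho
  have huG : ∀ e ∈ (u * G).support, d ≤ e.degree := by
    have h1 := forall_le_degree_mul (fun _ _ => Nat.zero_le _) hGdeg (P := u)
    simpa only [Nat.zero_add] using h1
  have hh1 : ∀ e ∈ h.support, 1 ≤ e.degree := forall_one_le_degree_of_mem_originIdeal hh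
  -- (ii) the transform of the ledger identity: `T_d(uG) = x_j x_{b′} · T_{d−1}S + T₀T · (T₁h)^d`
  have hshear : shear j b (u * G) = shear j b S * (X j * X b') + shear j b T * shear j b h ^ d := by
    rw [hGdef, hG]
    unfold shear
    simp only [map_add, map_mul, map_pow, aeval_X, if_true, if_neg hjb.symm, hbb, C_0, zero_mul,
      add_zero]
  have key : chartTransform d Finset.univ j (shear j b (u * G)) =
      (X j * X b') * chartTransform (d - 1) Finset.univ j (shear j b S) +
        chartTransform 0 Finset.univ j (shear j b T) * chartTransform 1 Finset.univ j (shear j b h) ^ d := by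
    apply mul_left_cancel₀ (pow_ne_zero d (X_ne_zero j))
    rw [X_pow_mul_chartTransform_univ j (forall_le_degree_shear j b huG), hshear, map_add, map_mul, map_mul,
      map_mul, map_pow, ← X_pow_mul_chartTransform_univ j (forall_le_degree_shear j b hS),
      ← X_pow_mul_chartTransform_univ j (forall_le_degree_shear j b hh1),
      ← X_pow_mul_chartTransform_univ j (fun _ _ => Nat.zero_le _) (m := 0) (P := shear j b T),
      coordBlowupSubst_X_self,
      coordBlowupSubst_X_of_mem_of_ne K _ j (Finset.mem_coe.mpr (Finset.mem_univ b')) hjb.symm, pow_one,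
      mul_pow, pow_zero, one_mul,
      show (X j : MvPolynomial (Fin 4) K) ^ d = X j ^ (d - 1) * X j by rw [← pow_succ, Nat.sub_add_cancel hd1]]
    ring
  -- (iii) `T₀u · T_dG = T_d(uG)`
  have hprod : chartTransform 0 Finset.univ j (shear j b u) * chartTransform d Finset.univ j (shear j b G) =
      chartTransform d Finset.univ j (shear j b (u * G)) := by
    rw [shear_mul, ← chartTransform_mul j (fun _ _ => Nat.zero_le _) (forall_le_degree_shear j b hGdeg),
      Nat.zero_add]
  -- (iv) the cleaned new residual (K5(a))
  have hG' : G' = U0 * chartTransform d Finset.univ j (shear j b G) - (X j * X b') ^ 2 * c := by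
    rw [← hc]; exact eq_sub_of_add_eq (divMonomial_step_F_add_deleted j hbj ho hr hqo.le)
  refine ⟨U0 * chartTransform (d - 1) Finset.univ j (shear j b S) -
    chartTransform 0 Finset.univ j (shear j b u) * (X j * X b') * c, ?_, ?_⟩
  · rw [hG', mul_sub, mul_left_comm, hprod, key]
    ring
  · rw [sub_sub_cancel_left]
    exact Submodule.neg_mem _ (Ideal.mul_mem_right _ _ (Ideal.mul_mem_left _ _ (Ideal.subset_span rfl)))

end Step

end ResCone

end Summit.ResolutionOfSingularities.ResolutionOfSingularities.Theorems.PIDim4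

end
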